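import Mathlib
import Summits.NavierStokesRegularity.NavierStokesRegularity.Theorems.FilamentSkeletonRssSelectionBoxRJRungNormalBlockDet
import Summits.NavierStokesRegularity.NavierStokesRegularity.Theorems.FilamentSkeletonRssSelectionBoxRJRungSlipLaw

/-!
# Route `FilamentSkeletonRss` · crux `SelectionBoxRJ` (stmt-NavierStokesRegularity-21220) — census:
# CLAUSE 12 (hyperbolic normal block) IS IMPLIED by the other skeleton clauses when `2Kρ ≤ 1`, for `Γ ≥ Γ₁₂`

Lane `ns-filament-19175-p1` (g8).  Helper file `--supports stmt-NavierStokesRegularity-21220`; route-independent (the same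
statement serves `TransverseReductionRJ` stmt-…-21221, the asides `SelectionBoxR` 19174 / `TransverseReductionR` 19175, and
`BoxClausesJ` of the registered line `action_gap_seam_J`).

THE STATEMENT (`clause12_of_skeleton`).  Fix box constants with `2Kρ ≤ 1` and `Γ` above the four explicit thresholds
`exp((Rw/Rb)² + 1)`, `(7104 π K)²`, `312 π (cg ρ + 2Rw)/(cg⁴ ρ³)`, `4π (12 N (ρ + 2Rw)/(θ₀ cg ρ³) + 2θ₀⁻¹ + 2)/θ₀`.  Let a
skeleton datum at one parameter value satisfy, in the VERBATIM vocabulary of `SelectionBoxRJ` / `TransverseReductionRJ`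
(`u`, `v` by their defining formulas), the clauses: `C²` unit-speed filaments with `‖X″‖√Γ ≤ K` and `w` differentiable
(clause 2), separation `ρ√Γ` (3), no-return `ρ√Γ ≤ |τ − σ| → cg ρ√Γ ≤ ‖X τ − X σ‖` (4), linear escape (5), tangency on the
ball `‖X‖ ≤ Rb√(Γ log Γ)` (7), waist `‖X(c)‖ ≤ Rw√Γ` (8), bounds `θ₀ ≤ |α|, |γ_j| ≤ θ₀⁻¹` (10), and of clause 11 only
`w(c) = 0` with the LOWER slope bound `3/2 + δ ≤ w′(c)`.  Then for EVERY filament `j` and EVERY orthonormal completion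
`(m, n)` of the tangent `X_j′(c_j)`, clause 12 holds with `A = Dv(X_j(c_j))`:
`⟪A m, m⟫ + ⟪A n, n⟫ < 0 ∧ ⟪A n, m⟫⟪A m, n⟫ < ⟪A m, m⟫⟪A n, n⟫`.

WHY.  Trace: `Dv` has trace `3/2` (`…RungDivFreeTrace`) and the tangent is an exact eigenvector with eigenvalue
`w′(c) ≥ 3/2 + δ` (`…RungSlipLaw.box_eigenvector_law`).  Determinant: at a point of filament `j` the normal block of
its own regularised Biot–Savart gradient is the core rotation `(Γγ_j/4π)·(≈ 2)` up to `O(ΓK/√Γ)` (`…RungNormalBlockSelf`;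
the regime `2Kρ ≤ 1` makes the no-return clause cover every strand the curvature bound does not), partners contribute
`O(1)` (separation + escape, `…RungPartnerStrain`), the frame part `½ id − α e₃×` contributes `O(θ₀⁻¹)`; rotation dominance
gives the determinant sign (`…RungNormalBlockDet`).

CONSEQUENCE (planner-facing census; no route edit implied).  In `SelectionBoxRJ` (∃-side) a witness never has to verify
clause 12: choose `ρ ≤ 1/(2K)` (the separation constant may always be lowered) and `Γ₂ ≥ Γ₁₂`.  In
`TransverseReductionRJ` (∀-side) clause 12 is a redundant hypothesis on the parameter region `2Kρ ≤ 1`.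

HONEST FRAMING.  Bookkeeping about a HYPOTHETICAL filament box; nothing here is a claim about Navier–Stokes regularity
or blow-up.
-/

set_option linter.dupNamespace false

noncomputable section

namespace Summit.NavierStokesRegularity.NavierStokesRegularity.Theorems

open Set Function Filter MeasureTheory Real
open Literature.Analysis.FluidPDE
open Summit.NavierStokesRegularity.NavierStokesRegularity.Theorems.SkeletonEquilibrium.Sketch
open scoped InnerProductSpace Topology

namespace SelectionBoxRJRung

/-- Scaling algebra of the partner/self majorant constants: `8π(a√Γ + b√Γ)/(c (d√Γ)³) = 8π(a + b)/(c d³ Γ)` for `Γ > 0`.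
[folklore] -/
theorem majorant_const_rescale {Γ : ℝ} (hΓ : 0 < Γ) (a b c d : ℝ) :
    8 * Real.pi * (a * Real.sqrt Γ + b * Real.sqrt Γ) / (c * (d * Real.sqrt Γ) ^ 3) =
      8 * Real.pi * (a + b) / (c * d ^ 3 * Γ) := by
  have hG : 0 < Real.sqrt Γ := Real.sqrt_pos.2 hΓ
  have hG2 : Real.sqrt Γ ^ 2 = Γ := Real.sq_sqrt hΓ.le
  have h3 : (d * Real.sqrt Γ) ^ 3 = d ^ 3 * Γ * Real.sqrt Γ := by
    rw [mul_pow, show Real.sqrt Γ ^ 3 = Real.sqrt Γ ^ 2 * Real.sqrt Γ by ring, hG2]; ring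
  rw [h3, ← add_mul]
  rcases eq_or_ne (c * d ^ 3) 0 with hcd | hcd
  · have : c * (d ^ 3 * Γ * Real.sqrt Γ) = 0 := by
      rw [show c * (d ^ 3 * Γ * Real.sqrt Γ) = (c * d ^ 3) * (Γ * Real.sqrt Γ) by ring, hcd, zero_mul]
    rw [show c * (d ^ 3 * Γ * Real.sqrt Γ) = c * (d ^ 3 * Γ * Real.sqrt Γ) by rfl, this,
      show c * d ^ 3 * Γ = (c * d ^ 3) * Γ by ring, hcd, zero_mul, div_zero, div_zero]
  · have hne : c * (d ^ 3 * Γ * Real.sqrt Γ) ≠ 0 := by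
      rw [show c * (d ^ 3 * Γ * Real.sqrt Γ) = (c * d ^ 3) * (Γ * Real.sqrt Γ) by ring]
      exact mul_ne_zero hcd (by positivity)
    rw [div_eq_div_iff hne (mul_ne_zero hcd hΓ.ne')]
    ring

/-- The numerical side of the threshold: above `Γ₁₂` the self errors satisfy `E₂ + 4E₁ ≤ 1/3` and the rotation
dominates, `6P + 2θ₀⁻¹ + 1 < (Γθ₀/4π) (4/3 − E₂ − 4E₁)`. [folklore] -/
theorem clause12_thresholds {N : ℕ} {Γ ρ K Rw cg θ₀ : ℝ} (hρ : 0 < ρ) (hRw : 0 < Rw) (hcg : 0 < cg)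
    (hθ₀ : 0 < θ₀) (hΓ0 : 1 ≤ Γ) (hΓ2 : (7104 * Real.pi * K) ^ 2 ≤ Γ)
    (hΓ3 : 312 * Real.pi * (cg * ρ + 2 * Rw) / (cg ^ 4 * ρ ^ 3) ≤ Γ)
    (hΓ4 : 4 * Real.pi * (12 * N * (ρ + 2 * Rw) / (θ₀ * cg * ρ ^ 3) + 2 * θ₀⁻¹ + 2) / θ₀ ≤ Γ) :
    (416 * Real.pi * (K / Real.sqrt Γ) + 20 * Real.pi * (cg * ρ * Real.sqrt Γ + 2 * Rw * Real.sqrt Γ) /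
        (cg * (cg * ρ * Real.sqrt Γ) ^ 3)) +
      4 * (192 * Real.pi * (K / Real.sqrt Γ) + 8 * Real.pi * (cg * ρ * Real.sqrt Γ + 2 * Rw * Real.sqrt Γ) /
        (cg * (cg * ρ * Real.sqrt Γ) ^ 3)) ≤ 1 / 3 ∧
    ∀ Q a : ℝ, Γ * θ₀ / (4 * Real.pi) ≤ Q → |a| ≤ θ₀⁻¹ →
      6 * (N * (Γ * θ₀⁻¹ / (4 * Real.pi) * (8 * Real.pi * (ρ * Real.sqrt Γ + 2 * Rw * Real.sqrt Γ) /
        (cg * (ρ * Real.sqrt Γ) ^ 3)))) + 2 * |a| + 1 <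
      Q * (4 / 3 - (416 * Real.pi * (K / Real.sqrt Γ) + 20 * Real.pi * (cg * ρ * Real.sqrt Γ + 2 * Rw * Real.sqrt Γ) /
        (cg * (cg * ρ * Real.sqrt Γ) ^ 3)) -
        4 * (192 * Real.pi * (K / Real.sqrt Γ) + 8 * Real.pi * (cg * ρ * Real.sqrt Γ + 2 * Rw * Real.sqrt Γ) /
        (cg * (cg * ρ * Real.sqrt Γ) ^ 3))) := by
  have hπ := Real.pi_gt_three
  have hΓ : 0 < Γ := by linarith
  have hG : 0 < Real.sqrt Γ := Real.sqrt_pos.2 hΓ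
  -- rescale the two majorant constants
  have hr1 : 8 * Real.pi * (cg * ρ * Real.sqrt Γ + 2 * Rw * Real.sqrt Γ) / (cg * (cg * ρ * Real.sqrt Γ) ^ 3) =
      8 * Real.pi * (cg * ρ + 2 * Rw) / (cg * (cg * ρ) ^ 3 * Γ) := majorant_const_rescale hΓ _ _ _ _
  have hr2 : 8 * Real.pi * (ρ * Real.sqrt Γ + 2 * Rw * Real.sqrt Γ) / (cg * (ρ * Real.sqrt Γ) ^ 3) =
      8 * Real.pi * (ρ + 2 * Rw) / (cg * ρ ^ 3 * Γ) := majorant_const_rescale hΓ _ _ _ _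
  have hr3 : 20 * Real.pi * (cg * ρ * Real.sqrt Γ + 2 * Rw * Real.sqrt Γ) / (cg * (cg * ρ * Real.sqrt Γ) ^ 3) =
      (5 / 2) * (8 * Real.pi * (cg * ρ * Real.sqrt Γ + 2 * Rw * Real.sqrt Γ) / (cg * (cg * ρ * Real.sqrt Γ) ^ 3)) := by
    ring
  rw [hr3, hr1, hr2]
  -- the `K/√Γ` terms
  have hK1 : Real.pi * (K / Real.sqrt Γ) ≤ 1 / 7104 := by
    have h1 : 7104 * Real.pi * K ≤ Real.sqrt Γ := Real.le_sqrt_of_sq_le hΓ2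
    rw [mul_div_assoc', div_le_div_iff₀ hG (by norm_num)]
    linarith
  -- the `1/Γ` terms
  have hq : 0 < cg * (cg * ρ) ^ 3 := by positivity
  have hK2 : 8 * Real.pi * (cg * ρ + 2 * Rw) / (cg * (cg * ρ) ^ 3 * Γ) ≤ 1 / 39 := by
    rw [div_le_div_iff₀ (by positivity) (by norm_num)]
    have h1 : 312 * Real.pi * (cg * ρ + 2 * Rw) ≤ Γ * (cg ^ 4 * ρ ^ 3) := (div_le_iff₀ (by positivity)).1 hΓ3
    nlinarith
  have hE : (5 / 2) * (8 * Real.pi * (cg * ρ + 2 * Rw) / (cg * (cg * ρ) ^ 3 * Γ)) +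
        416 * (Real.pi * (K / Real.sqrt Γ)) +
      4 * (192 * (Real.pi * (K / Real.sqrt Γ)) + 8 * Real.pi * (cg * ρ + 2 * Rw) / (cg * (cg * ρ) ^ 3 * Γ)) ≤ 1 / 3 := by
    linarith
  constructor
  · linarith
  · intro Q a hQ ha
    -- the partner constant is `Γ`-free
    have hP : N * (Γ * θ₀⁻¹ / (4 * Real.pi) * (8 * Real.pi * (ρ + 2 * Rw) / (cg * ρ ^ 3 * Γ))) =
        2 * N * (ρ + 2 * Rw) / (θ₀ * cg * ρ ^ 3) := by
      field_simp
      ring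
    rw [hP]
    have hQ' : 12 * N * (ρ + 2 * Rw) / (θ₀ * cg * ρ ^ 3) + 2 * θ₀⁻¹ + 2 ≤ Γ * θ₀ / (4 * Real.pi) := by
      have h := (div_le_iff₀ hθ₀).1 hΓ4
      rw [le_div_iff₀ (by positivity)]
      linarith
    have hN0 : 0 ≤ 12 * N * (ρ + 2 * Rw) / (θ₀ * cg * ρ ^ 3) := by positivity
    have hQ0 : 0 ≤ Q := le_trans (by positivity) hQ
    have hfac : 1 ≤ 4 / 3 - (416 * (Real.pi * (K / Real.sqrt Γ)) +
        (5 / 2) * (8 * Real.pi * (cg * ρ + 2 * Rw) / (cg * (cg * ρ) ^ 3 * Γ))) -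
        4 * (192 * (Real.pi * (K / Real.sqrt Γ)) + 8 * Real.pi * (cg * ρ + 2 * Rw) / (cg * (cg * ρ) ^ 3 * Γ)) := by
      linarith
    have hmul : Q * 1 ≤ Q * (4 / 3 - (416 * (Real.pi * (K / Real.sqrt Γ)) +
        (5 / 2) * (8 * Real.pi * (cg * ρ + 2 * Rw) / (cg * (cg * ρ) ^ 3 * Γ))) -
        4 * (192 * (Real.pi * (K / Real.sqrt Γ)) + 8 * Real.pi * (cg * ρ + 2 * Rw) / (cg * (cg * ρ) ^ 3 * Γ))) :=
      mul_le_mul_of_nonneg_left hfac hQ0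
    have e1 : 416 * Real.pi * (K / Real.sqrt Γ) = 416 * (Real.pi * (K / Real.sqrt Γ)) := by ring
    have e2 : 192 * Real.pi * (K / Real.sqrt Γ) = 192 * (Real.pi * (K / Real.sqrt Γ)) := by ring
    rw [e1, e2]
    have h1 : 6 * (2 * (N : ℝ) * (ρ + 2 * Rw) / (θ₀ * cg * ρ ^ 3)) = 12 * N * (ρ + 2 * Rw) / (θ₀ * cg * ρ ^ 3) := by
      ring
    rw [h1]
    calc _ < Q * 1 := by linarith
      _ ≤ _ := hmul

/-! ### Clause 12 from the other clauses -/

/-- **Clause 12 is implied (regime `2Kρ ≤ 1`, `Γ ≥ Γ₁₂`).**  See the module docstring: for a skeleton datum satisfying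
clauses 2, 3, 4, 5, 7, 8, 10 and `w_j(c_j) = 0`, `3/2 + δ ≤ w_j′(c_j)` of `SelectionBoxRJ` / `TransverseReductionRJ`
(with `u`, `v` given by their defining formulas), every filament `j` and every orthonormal completion `(m, n)` of
`X_j′(c_j)` satisfy the normal-block clause `⟪A m, m⟫ + ⟪A n, n⟫ < 0 ∧ ⟪A n, m⟫⟪A m, n⟫ < ⟪A m, m⟫⟪A n, n⟫`,
`A = Dv(X_j(c_j))`. [folklore] -/
theorem clause12_of_skeleton {N : ℕ} {Γ δ ρ K Rw Rb cg θ₀ : ℝ} (hδ : 0 < δ) (hρ : 0 < ρ) (hRw : 0 < Rw)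
    (hRb : 0 < Rb) (hcg : 0 < cg) (hθ₀ : 0 < θ₀) (hKρ : 2 * K * ρ ≤ 1)
    (hΓ1 : Real.exp ((Rw / Rb) ^ 2 + 1) ≤ Γ) (hΓ2 : (7104 * Real.pi * K) ^ 2 ≤ Γ)
    (hΓ3 : 312 * Real.pi * (cg * ρ + 2 * Rw) / (cg ^ 4 * ρ ^ 3) ≤ Γ)
    (hΓ4 : 4 * Real.pi * (12 * N * (ρ + 2 * Rw) / (θ₀ * cg * ρ ^ 3) + 2 * θ₀⁻¹ + 2) / θ₀ ≤ Γ)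
    {γ : Fin N → ℝ} {α : ℝ} {X : Fin N → ℝ → EuclideanSpace ℝ (Fin 3)} {w : Fin N → ℝ → ℝ} {c : Fin N → ℝ}
    {u : (Fin N → ℝ → EuclideanSpace ℝ (Fin 3)) → EuclideanSpace ℝ (Fin 3) → EuclideanSpace ℝ (Fin 3)}
    {v : EuclideanSpace ℝ (Fin 3) → EuclideanSpace ℝ (Fin 3)}
    (hu : ∀ Z y, u Z y = ∑ k, (Γ * γ k / (4 * Real.pi)) •
      ∫ σ : ℝ, ((‖y - Z k σ‖ ^ 2 + 1) ^ (3 / 2 : ℝ))⁻¹ • cross (deriv (Z k) σ) (y - Z k σ))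
    (hv : ∀ y, v y = u X y + (1 / 2 : ℝ) • y - α • cross (EuclideanSpace.single 2 1) y)
    (hreg : ∀ j, ContDiff ℝ 2 (X j) ∧ Differentiable ℝ (w j) ∧ (∀ τ, ‖deriv (X j) τ‖ = 1) ∧
      (∀ τ, ‖iteratedDeriv 2 (X j) τ‖ * Real.sqrt Γ ≤ K))
    (hsep : ∀ j k, j ≠ k → ∀ τ σ, ρ * Real.sqrt Γ ≤ ‖X j τ - X k σ‖)
    (hnoret : ∀ j τ σ, ρ * Real.sqrt Γ ≤ |τ - σ| → cg * ρ * Real.sqrt Γ ≤ ‖X j τ - X j σ‖)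
    (hesc : ∀ j τ, cg * |τ - c j| ≤ Rw * Real.sqrt Γ + ‖X j τ‖)
    (htan : ∀ j τ, ‖X j τ‖ ≤ Rb * Real.sqrt (Γ * Real.log Γ) → v (X j τ) = w j τ • deriv (X j) τ)
    (hwaist : ∀ j, ‖X j (c j)‖ ≤ Rw * Real.sqrt Γ)
    (hbds : θ₀ ≤ |α| ∧ |α| ≤ θ₀⁻¹ ∧ ∀ j, θ₀ ≤ |γ j| ∧ |γ j| ≤ θ₀⁻¹)
    (hstag : ∀ j, w j (c j) = 0 ∧ 3 / 2 + δ ≤ deriv (w j) (c j))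
    (j : Fin N) {m n : EuclideanSpace ℝ (Fin 3)} (hon : Orthonormal ℝ ![deriv (X j) (c j), m, n]) :
    ⟪fderiv ℝ v (X j (c j)) m, m⟫_ℝ + ⟪fderiv ℝ v (X j (c j)) n, n⟫_ℝ < 0 ∧
    ⟪fderiv ℝ v (X j (c j)) n, m⟫_ℝ * ⟪fderiv ℝ v (X j (c j)) m, n⟫_ℝ <
      ⟪fderiv ℝ v (X j (c j)) m, m⟫_ℝ * ⟪fderiv ℝ v (X j (c j)) n, n⟫_ℝ := by
  have hπ := Real.pi_gt_three
  have hΓ0 : 1 ≤ Γ := le_trans (Real.one_le_exp (by positivity)) hΓ1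
  have hΓ : 0 < Γ := by linarith
  have hG : 0 < Real.sqrt Γ := Real.sqrt_pos.2 hΓ
  -- the frame velocity as an explicit function
  obtain ⟨coef, hcoef⟩ : ∃ coef : Fin N → ℝ, coef = fun k => Γ * γ k / (4 * Real.pi) := ⟨_, rfl⟩
  have hvfun : v = fun y : EuclideanSpace ℝ (Fin 3) =>
      (∑ k, coef k • ∫ σ : ℝ, ((‖y - X k σ‖ ^ 2 + 1) ^ (3 / 2 : ℝ))⁻¹ • cross (deriv (X k) σ) (y - X k σ))
        + (1 / 2 : ℝ) • y - α • cross (EuclideanSpace.single 2 1) y := by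
    funext y; rw [hv y, hu X y, hcoef]
  -- hypotheses of the Biot–Savart stubs for every filament
  have hX1 : ∀ k, ContDiff ℝ 1 (X k) := fun k => (hreg k).1.of_le (by norm_num)
  have hdX : ∀ k τ, ‖deriv (X k) τ‖ ≤ 1 := fun k τ => ((hreg k).2.2.1 τ).le
  have hgrow : ∀ k τ, cg * |τ| - (cg * |c k| + Rw * Real.sqrt Γ) ≤ ‖X k τ‖ := by
    intro k τ
    have h1 := hesc k τ
    have h2 : |τ| - |c k| ≤ |τ - c k| := abs_sub_abs_le_abs_sub τ (c k)
    nlinarith [hcg]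
  -- geometry of filament `j` seen from its stagnation point
  obtain ⟨hXj, hwj, hunit, hcurv⟩ := hreg j
  have hκ : ∀ τ, ‖deriv (deriv (X j)) τ‖ ≤ K / Real.sqrt Γ := fun τ => by
    rw [le_div_iff₀ hG, ← iteratedDeriv_one (f := X j), ← iteratedDeriv_succ]; exact hcurv τ
  have hS₁ : K / Real.sqrt Γ * (ρ * Real.sqrt Γ) ≤ 1 / 2 := by
    rw [show K / Real.sqrt Γ * (ρ * Real.sqrt Γ) = K * ρ by field_simp]; linarith
  have hD₁ : 0 < cg * ρ * Real.sqrt Γ := by positivity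
  have hA₁ : 0 ≤ 2 * Rw * Real.sqrt Γ := by positivity
  have hfar : ∀ τ, ρ * Real.sqrt Γ ≤ |τ - c j| → cg * ρ * Real.sqrt Γ ≤ ‖X j (c j) - X j τ‖ := fun τ hτ =>
    hnoret j (c j) τ (by rwa [abs_sub_comm])
  have hescj : ∀ τ, cg * |τ - c j| - 2 * Rw * Real.sqrt Γ ≤ ‖X j (c j) - X j τ‖ := fun τ => by
    have h1 := hesc j τ
    have h2 := hwaist j
    have h3 : ‖X j τ‖ - ‖X j (c j)‖ ≤ ‖X j (c j) - X j τ‖ := by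
      rw [norm_sub_rev]; exact norm_sub_norm_le _ _
    linarith
  -- the partners seen from the stagnation point
  have hpfar : ∀ k, k ≠ j → ∀ τ, ρ * Real.sqrt Γ ≤ ‖X j (c j) - X k τ‖ := fun k hk τ => hsep j k hk.symm (c j) τ
  have hpesc : ∀ k, k ≠ j → ∀ τ, cg * |τ - c k| - 2 * Rw * Real.sqrt Γ ≤ ‖X j (c j) - X k τ‖ := fun k _ τ => by
    have h1 := hesc k τ
    have h2 := hwaist j
    have h3 : ‖X k τ‖ - ‖X j (c j)‖ ≤ ‖X j (c j) - X k τ‖ := by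
      rw [norm_sub_rev]; exact norm_sub_norm_le _ _
    linarith
  have hCκ0 : 0 ≤ Γ * θ₀⁻¹ / (4 * Real.pi) := by positivity
  have hCκ : ∀ k, k ≠ j → |coef k| ≤ Γ * θ₀⁻¹ / (4 * Real.pi) := fun k _ => by
    rw [hcoef]; dsimp only
    rw [abs_div, abs_mul, abs_of_pos hΓ, abs_of_pos (by positivity : (0:ℝ) < 4 * Real.pi)]
    exact div_le_div_of_nonneg_right (mul_le_mul_of_nonneg_left (hbds.2.2 k).2 hΓ.le) (by positivity)
  have hQ : Γ * θ₀ / (4 * Real.pi) ≤ |coef j| := by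
    rw [hcoef]; dsimp only
    rw [abs_div, abs_mul, abs_of_pos hΓ, abs_of_pos (by positivity : (0:ℝ) < 4 * Real.pi)]
    exact div_le_div_of_nonneg_right (mul_le_mul_of_nonneg_left (hbds.2.2 j).1 hΓ.le) (by positivity)
  -- thresholds
  obtain ⟨-, hbigQ⟩ := clause12_thresholds (N := N) hρ hRw hcg hθ₀ hΓ0 hΓ2 hΓ3 hΓ4
  have hbig := hbigQ |coef j| α hQ hbds.2.1
  -- the determinant half
  have hdet := normalBlock_det_pos (coef := coef) (α := α) (u₀ := c) hcg hX1 hdX hgrow hXj hunit hκ hS₁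
    hcg hD₁ hA₁ hfar hescj (mul_pos hρ hG) hcg hA₁ hpfar hpesc hCκ0 hCκ hon hbig
  -- the trace half: trace `3/2`, the tangent is an eigenvector with eigenvalue `w′(c) ≥ 3/2 + δ`
  have htr : ∀ {ι : Type} [Fintype ι] (b : OrthonormalBasis ι ℝ (EuclideanSpace ℝ (Fin 3))),
      ∑ i, ⟪b i, fderiv ℝ v (X j (c j)) (b i)⟫_ℝ = 3 / 2 := by
    intro ι _ b
    have h := skeletonField_trace_eq (coef := coef) (α := α) one_ne_zero hcg hX1 hdX hgrow b (X j (c j))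
    rw [hvfun]; simpa only [one_pow] using h
  have hdiffv : DifferentiableAt ℝ v (X j (c j)) := by
    by_contra h
    have h1 := htr (EuclideanSpace.basisFun (Fin 3) ℝ)
    rw [fderiv_zero_of_not_differentiableAt h] at h1
    norm_num at h1
  have hball : ∀ᶠ τ in 𝓝 (c j), v (X j τ) = w j τ • deriv (X j) τ := by
    have hlog : (Rw / Rb) ^ 2 < Real.log Γ := by
      have h := (Real.le_log_iff_exp_le hΓ).2 hΓ1
      linarith
    have hlt : Rw * Real.sqrt Γ < Rb * Real.sqrt (Γ * Real.log Γ) := by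
      have h1 : Rw / Rb < Real.sqrt (Real.log Γ) := (Real.lt_sqrt (by positivity)).2 hlog
      have h2 : Rw < Rb * Real.sqrt (Real.log Γ) := by rwa [div_lt_iff₀' hRb] at h1
      calc Rw * Real.sqrt Γ < (Rb * Real.sqrt (Real.log Γ)) * Real.sqrt Γ := mul_lt_mul_of_pos_right h2 hG
        _ = Rb * Real.sqrt (Γ * Real.log Γ) := by rw [Real.sqrt_mul hΓ.le]; ring
    have hopen : IsOpen {τ : ℝ | ‖X j τ‖ < Rb * Real.sqrt (Γ * Real.log Γ)} :=
      isOpen_lt (hXj.continuous.norm) continuous_const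
    have hmem : c j ∈ {τ : ℝ | ‖X j τ‖ < Rb * Real.sqrt (Γ * Real.log Γ)} := lt_of_le_of_lt (hwaist j) hlt
    exact Filter.eventually_of_mem (hopen.mem_nhds hmem) fun τ hτ => htan j τ (le_of_lt hτ)
  have hAt : fderiv ℝ v (X j (c j)) (deriv (X j) (c j)) = deriv (w j) (c j) • deriv (X j) (c j) :=
    box_eigenvector_law hXj hwj (hstag j).1 hdiffv hball
  have htrace := normalBlock_trace_neg (fderiv ℝ v (X j (c j))) hon hAt htr hδ (hstag j).2
  refine ⟨htrace, ?_⟩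
  rw [hvfun]
  exact hdet

end SelectionBoxRJRung

end Summit.NavierStokesRegularity.NavierStokesRegularity.Theorems
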